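import Summits.FinalStateConjecture.FinalStateConjecture.Theorems.ZeroEnergyKerrOrBombStationaryLimitReductionKerrIsometryRigidityWave3Facts
import Summits.FinalStateConjecture.FinalStateConjecture.Theorems.ZeroEnergyKerrOrBombStationaryLimitReductionTimeEquivariantMaps
import Literature.Geometry.Lorentzian.MultiCentreKerrSchild
import Literature.Geometry.Lorentzian.KerrWaveEnergy
import HarnessLib

/-!
# Route ZeroEnergyKerrOrBomb · crux `FinalStateFromKerrOrBomb` (stmt-FinalStateConjecture-17839), line
# `SketchIdeator1` — stub `stub_kerrAsymptoticRigidity` (F4 of stub 1R), layers 1–2: the time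
# normalisation `c = 1` and two-sided bounds on `dΘ` far out

Helper file (`--supports stmt-FinalStateConjecture-17839`; registered helpers
`kerrAsymptoticRigidity_c_eq_one`, `kerrAsymptoticRigidity_fderiv_bounded`) of the lead's wave-2
stub-worker for `stub_kerrAsymptoticRigidity : SigM.stub_kerrAsymptoticRigidity` (`:= KerrAsymptoticRigidity`,
obligation F4 of stub 1R, `…KerrIsometryRigidityWave3Facts`). Both theorems carry VERBATIM the binder list of
`KerrAsymptoticRigidity` (so that the layers chain), and prove the first two steps of its classical route:

* §1 linear algebra of bilinear forms `B` on `E4` with `‖B − η‖ ≤ 1/4`: the `B`-orthogonal complement of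
  `e₀` is uniformly spacelike (`‖w‖² ≤ 2 B(w, w)`, `|w⁰| ≤ ‖w‖/4`), `B(e₀, e₀) ≤ −3/4`, `|B(e₀, v)| ≤ 5‖v‖/4`;
  whence (`norm_le_of_intertwines`) a linear map `D` with `D e₀ = c e₀`, `c > 0`, intertwining two such
  forms, `B_A(D v, D w) = B_K(v, w)`, satisfies `‖D‖ ≤ 16/3 + 5c/3` and `‖v‖ ≤ (16/3 + 5/(3c)) ‖D v‖`
  (split `v = v' + λ e₀` with `B_K(e₀, v') = 0`; `D v'` is `B_A`-orthogonal to `e₀`);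
* §2 `kerrAsymptoticRigidity_c_eq_one`: under the hypotheses of F4, `c = 1` — at a far point `x` of the
  Kerr exterior, `c² A.bilin (Θ x)(e₀, e₀) = g_{M,a}(x)(e₀, e₀) = −1 + 2H(x)` (`dΘ e₀ = c e₀`, the isometry
  clause, `Kerr.bilin_basisVector`), `0 ≤ 2H ≤ 2M/r` (`Kerr.scalarH_le_div`) and
  `|A.bilin (Θ x)(e₀, e₀) + 1| ≤ ε` (clause (1) of `ChartIsAsymptoticallyCartesian` at `A`-radius `→ ∞`,
  the end-matching clause), so `|c² − 1| ≤ c² ε + 2M/r` for every `ε > 0` and all large `r`;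
* §3 `kerrAsymptoticRigidity_fderiv_bounded`: under the hypotheses of F4 there are `R, L` with
  `‖dΘ_u‖ ≤ L` and `‖v‖ ≤ L ‖dΘ_u v‖` for `u` in the exterior with `r(u) ≥ R` (§1 with
  `B_K = g_{M,a}(u)`, `‖g_{M,a} − η‖ ≤ C/r`, `Kerr.exists_norm_ksPert_le`, and `B_A = A.bilin (Θ u)`).

Elementary; no named fact, nothing restated. References: B. O'Neill, *Semi-Riemannian Geometry* (1983),
Ch. 5, Lemma 5.26 (orthogonal complements of timelike vectors); P. T. Chruściel, J. L. Costa,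
arXiv:0806.0016, §2.1; R. Bartnik, CPAM 39 (1986), §3.
-/

set_option linter.dupNamespace false

-- instance search through the nested operator types `E4 →L[ℝ] E4 →L[ℝ] ℝ`
set_option maxSynthPendingDepth 3

noncomputable section

open scoped Manifold ContDiff Topology
open Set Filter Function

namespace Summit.FinalStateConjecture.FinalStateConjecture.Theorems.SymplecticDualOfTheBomb

open Literature.Geometry.Lorentzian
open Summit.FinalStateConjecture.FinalStateConjecture.Theorems.OneLockedExplosion

/-! ## §1 Bilinear forms `1/4`-close to `η` -/

section NearMinkowski

variable {B : E4 →L[ℝ] E4 →L[ℝ] ℝ}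

/-- `‖e₀‖ = 1`. [folklore] -/
private theorem norm_basisVector_zero : ‖(E4.basisVector 0 : E4)‖ = 1 := by
  rw [E4.basisVector, PiLp.norm_single, norm_one]

/-- `η(w, w) = ‖w‖² − 2 (w⁰)²` (Euclidean norm of `E4`). [folklore] -/
private theorem minkowski_self_eq (w : E4) : Minkowski.bilin w w = ‖w‖ ^ 2 - 2 * w 0 ^ 2 := by
  have h : ‖w‖ ^ 2 = w 0 ^ 2 + ∑ i : Fin 3, w i.succ ^ 2 := by
    rw [EuclideanSpace.real_norm_sq_eq, Fin.sum_univ_succ]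
  rw [Minkowski.bilin_apply, h]
  have h2 : ∑ i : Fin 3, w i.succ * w i.succ = ∑ i : Fin 3, w i.succ ^ 2 :=
    Finset.sum_congr rfl fun i _ ↦ by ring
  rw [h2]
  ring

/-- `|B(v, w) − η(v, w)| ≤ ‖v‖ ‖w‖ / 4` for `‖B − η‖ ≤ 1/4`. [folklore] -/
private theorem abs_sub_minkowski_le (hB : ‖B - Minkowski.bilin‖ ≤ 1 / 4) (v w : E4) :
    |B v w - Minkowski.bilin v w| ≤ ‖v‖ * ‖w‖ / 4 := by
  have h := (B - Minkowski.bilin).le_opNorm₂ v w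
  rw [Real.norm_eq_abs, sub_apply, sub_apply] at h
  calc |B v w - Minkowski.bilin v w| ≤ ‖B - Minkowski.bilin‖ * ‖v‖ * ‖w‖ := h
    _ ≤ 1 / 4 * ‖v‖ * ‖w‖ := by gcongr
    _ = ‖v‖ * ‖w‖ / 4 := by ring

/-- **The `B`-orthogonal complement of `e₀` is uniformly spacelike**: if `‖B − η‖ ≤ 1/4` and
`B(e₀, w) = 0` then `|w⁰| ≤ ‖w‖/4` and `‖w‖² ≤ 2 B(w, w)`. O'Neill 1983, Ch. 5, Lemma 5.26
(quantitative form). [folklore] -/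
private theorem orthogonal_estimates (hB : ‖B - Minkowski.bilin‖ ≤ 1 / 4) {w : E4}
    (hw : B (E4.basisVector 0) w = 0) : |w 0| ≤ ‖w‖ / 4 ∧ ‖w‖ ^ 2 ≤ 2 * B w w := by
  have h0 := abs_sub_minkowski_le hB (E4.basisVector 0) w
  rw [hw, Minkowski.bilin_basisVector_zero_left, norm_basisVector_zero, one_mul, zero_sub,
    neg_neg] at h0
  have h1 := abs_sub_minkowski_le hB w w
  rw [minkowski_self_eq] at h1
  refine ⟨h0, ?_⟩
  have hw0 : w 0 ^ 2 ≤ (‖w‖ / 4) ^ 2 := by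
    rw [← sq_abs (w 0)]
    exact pow_le_pow_left₀ (abs_nonneg _) h0 2
  nlinarith [(abs_le.1 h1).1, norm_nonneg w]

/-- `B(e₀, e₀) ≤ −3/4` for `‖B − η‖ ≤ 1/4`. [folklore] -/
private theorem apply_basisVector_zero_le (hB : ‖B - Minkowski.bilin‖ ≤ 1 / 4) :
    B (E4.basisVector 0) (E4.basisVector 0) ≤ -(3 / 4) := by
  have h := abs_sub_minkowski_le hB (E4.basisVector 0) (E4.basisVector 0)
  rw [Minkowski.bilin_basisVector_zero, norm_basisVector_zero, mul_one] at h
  linarith [(abs_le.1 h).2]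

/-- `|B(e₀, v)| ≤ 5‖v‖/4` for `‖B − η‖ ≤ 1/4`. [folklore] -/
private theorem abs_apply_basisVector_zero_le (hB : ‖B - Minkowski.bilin‖ ≤ 1 / 4) (v : E4) :
    |B (E4.basisVector 0) v| ≤ 5 * ‖v‖ / 4 := by
  have h := abs_sub_minkowski_le hB (E4.basisVector 0) v
  rw [Minkowski.bilin_basisVector_zero_left, norm_basisVector_zero, one_mul] at h
  have hv0 : |v 0| ≤ ‖v‖ := by
    have := PiLp.norm_apply_le v 0
    rwa [Real.norm_eq_abs] at this
  have := abs_sub_abs_le_abs_sub (B (E4.basisVector 0) v) (-v 0)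
  rw [abs_neg] at this
  linarith

/-- `B(v, v) ≤ 5‖v‖²/4` for `‖B − η‖ ≤ 1/4`. [folklore] -/
private theorem apply_self_le (hB : ‖B - Minkowski.bilin‖ ≤ 1 / 4) (v : E4) :
    B v v ≤ 5 * ‖v‖ ^ 2 / 4 := by
  have h := abs_sub_minkowski_le hB v v
  rw [minkowski_self_eq] at h
  nlinarith [(abs_le.1 h).2, sq_nonneg (v 0)]

/-- `‖p‖ ≤ 2‖q‖` from `‖p‖² ≤ 4‖q‖²`. [folklore] -/
private theorem norm_le_two_mul_of_sq_le {p q : E4} (h : ‖p‖ ^ 2 ≤ 4 * ‖q‖ ^ 2) : ‖p‖ ≤ 2 * ‖q‖ := by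
  have h' : ‖p‖ ^ 2 ≤ (2 * ‖q‖) ^ 2 := by nlinarith
  exact (pow_le_pow_iff_left₀ (norm_nonneg p) (by positivity) two_ne_zero).1 h'

/-- **Two-sided bounds for a linear map intertwining two near-Minkowski forms and fixing the time axis
up to `c > 0`**: if `‖B_K − η‖ ≤ 1/4`, `‖B_A − η‖ ≤ 1/4`, `D e₀ = c e₀` and `B_A(D v, D w) = B_K(v, w)`,
then `‖D‖ ≤ 16/3 + 5c/3` and `‖v‖ ≤ (16/3 + 5/(3c)) ‖D v‖`. Split `v = v' + λ e₀` with `B_K(e₀, v') = 0`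
(`|λ| ≤ 5‖v‖/3`, `‖v'‖ ≤ 8‖v‖/3`); then `w = D v'` is `B_A`-orthogonal to `e₀`, so
`‖w‖² ≤ 2 B_A(w, w) = 2 B_K(v', v') ≤ 4 ‖v'‖²` and symmetrically `‖v'‖ ≤ 2 ‖w‖`, while
`(D v)⁰ = w⁰ + λ c` with `|w⁰| ≤ ‖w‖/4` controls `λ`. O'Neill 1983, Ch. 5, Lemma 5.26. [folklore] -/
private theorem norm_le_of_intertwines {BK BA : E4 →L[ℝ] E4 →L[ℝ] ℝ} {D : E4 →L[ℝ] E4} {c : ℝ}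
    (hK : ‖BK - Minkowski.bilin‖ ≤ 1 / 4) (hA : ‖BA - Minkowski.bilin‖ ≤ 1 / 4) (hc : 0 < c)
    (hD0 : D (E4.basisVector 0) = c • E4.basisVector 0) (hiso : ∀ v w, BA (D v) (D w) = BK v w) :
    ‖D‖ ≤ 16 / 3 + 5 * c / 3 ∧ ∀ v, ‖v‖ ≤ (16 / 3 + 5 / (3 * c)) * ‖D v‖ := by
  have h00 := apply_basisVector_zero_le hK
  have h00' : BK (E4.basisVector 0) (E4.basisVector 0) ≠ 0 := by linarith
  -- the decomposition `v = v' + λ e₀`, `B_K(e₀, v') = 0`, and its estimates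
  have key : ∀ v : E4, ∃ (l : ℝ) (v' w : E4), v = v' + l • E4.basisVector 0 ∧ w = D v' ∧
      D v = w + (l * c) • E4.basisVector 0 ∧ |l| ≤ 5 * ‖v‖ / 3 ∧ ‖v'‖ ≤ 8 * ‖v‖ / 3 ∧
      |w 0| ≤ ‖w‖ / 4 ∧ ‖w‖ ≤ 2 * ‖v'‖ ∧ ‖v'‖ ≤ 2 * ‖w‖ := by
    intro v
    set l : ℝ := BK (E4.basisVector 0) v / BK (E4.basisVector 0) (E4.basisVector 0) with hl
    set v' : E4 := v - l • E4.basisVector 0 with hv'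
    have hv'0 : BK (E4.basisVector 0) v' = 0 := by
      rw [hv', map_sub, map_smul, smul_eq_mul, hl, div_mul_cancel₀ _ h00', sub_self]
    have hw0 : BA (E4.basisVector 0) (D v') = 0 := by
      have h := hiso (E4.basisVector 0) v'
      rw [hv'0, hD0] at h
      simp only [map_smul, FunLike.coe_smul, Pi.smul_apply, smul_eq_mul] at h
      exact (mul_eq_zero.1 h).resolve_left hc.ne'
    obtain ⟨hw00, hww⟩ := orthogonal_estimates hA hw0
    obtain ⟨-, hvv⟩ := orthogonal_estimates hK hv'0
    have hl1 : |l| ≤ 5 * ‖v‖ / 3 := by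
      rw [hl, abs_div]
      have h1 := abs_apply_basisVector_zero_le hK v
      have h2 : 3 / 4 ≤ |BK (E4.basisVector 0) (E4.basisVector 0)| := by
        rw [abs_of_neg (by linarith)]
        linarith
      rw [div_le_iff₀ (by linarith)]
      nlinarith [norm_nonneg v]
    have hv'n : ‖v'‖ ≤ 8 * ‖v‖ / 3 := by
      calc ‖v'‖ ≤ ‖v‖ + ‖l • (E4.basisVector 0 : E4)‖ := norm_sub_le _ _
        _ = ‖v‖ + |l| := by rw [norm_smul, norm_basisVector_zero, mul_one, Real.norm_eq_abs]
        _ ≤ 8 * ‖v‖ / 3 := by linarith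
    have hwle : ‖D v'‖ ≤ 2 * ‖v'‖ := by
      refine norm_le_two_mul_of_sq_le ?_
      have := apply_self_le hK v'
      rw [hiso] at hww
      nlinarith
    have hv'le : ‖v'‖ ≤ 2 * ‖D v'‖ := by
      refine norm_le_two_mul_of_sq_le ?_
      have := apply_self_le hA (D v')
      rw [← hiso] at hvv
      nlinarith
    refine ⟨l, v', D v', ?_, rfl, ?_, hl1, hv'n, hw00, hwle, hv'le⟩
    · rw [hv', sub_add_cancel]
    · conv_lhs => rw [show v = v' + l • E4.basisVector 0 by rw [hv', sub_add_cancel]]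
      rw [map_add, map_smul, hD0, smul_smul]
  constructor
  · refine ContinuousLinearMap.opNorm_le_bound _ (by positivity) fun v ↦ ?_
    obtain ⟨l, v', w, -, -, hDv, hl, hv', -, hw, -⟩ := key v
    calc ‖D v‖ = ‖w + (l * c) • (E4.basisVector 0 : E4)‖ := by rw [hDv]
      _ ≤ ‖w‖ + ‖(l * c) • (E4.basisVector 0 : E4)‖ := norm_add_le _ _
      _ = ‖w‖ + |l| * c := by
          rw [norm_smul, norm_basisVector_zero, mul_one, Real.norm_eq_abs, abs_mul, abs_of_pos hc]
      _ ≤ 2 * (8 * ‖v‖ / 3) + 5 * ‖v‖ / 3 * c := by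
          gcongr
          exact hw.trans (by linarith)
      _ = (16 / 3 + 5 * c / 3) * ‖v‖ := by ring
  · intro v
    obtain ⟨l, v', w, hv, -, hDv, -, -, hw0, hw, hv'⟩ := key v
    have hDv0 : D v 0 = w 0 + l * c := by
      rw [hDv]
      simp
    have h1 : |D v 0| ≤ ‖D v‖ := by
      have := PiLp.norm_apply_le (D v) 0
      rwa [Real.norm_eq_abs] at this
    have h2 : ‖w‖ ≤ ‖D v‖ + |l| * c := by
      have e : w = D v - (l * c) • E4.basisVector 0 := by rw [hDv, add_sub_cancel_right]
      calc ‖w‖ = ‖D v - (l * c) • (E4.basisVector 0 : E4)‖ := by rw [← e]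
        _ ≤ ‖D v‖ + ‖(l * c) • (E4.basisVector 0 : E4)‖ := norm_sub_le _ _
        _ = ‖D v‖ + |l| * c := by
            rw [norm_smul, norm_basisVector_zero, mul_one, Real.norm_eq_abs, abs_mul, abs_of_pos hc]
    have h3 : |l| * c ≤ |D v 0| + |w 0| := by
      rw [← abs_of_pos hc, ← abs_mul]
      have e : l * c = D v 0 - w 0 := by rw [hDv0]; ring
      rw [e]
      exact abs_sub _ _
    have hlc : |l| * c ≤ 5 * ‖D v‖ / 3 := by nlinarith [norm_nonneg (D v)]
    have hwn : ‖w‖ ≤ 8 * ‖D v‖ / 3 := by linarith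
    have hl' : |l| ≤ 5 / (3 * c) * ‖D v‖ := by
      rw [div_mul_eq_mul_div, le_div_iff₀ (by positivity)]
      nlinarith
    calc ‖v‖ = ‖v' + l • (E4.basisVector 0 : E4)‖ := by rw [← hv]
      _ ≤ ‖v'‖ + ‖l • (E4.basisVector 0 : E4)‖ := norm_add_le _ _
      _ = ‖v'‖ + |l| := by rw [norm_smul, norm_basisVector_zero, mul_one, Real.norm_eq_abs]
      _ ≤ 2 * (8 * ‖D v‖ / 3) + 5 / (3 * c) * ‖D v‖ := by
          gcongr
          exact hv'.trans (by linarith)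
      _ = (16 / 3 + 5 / (3 * c)) * ‖D v‖ := by ring

end NearMinkowski

/-! ## §2 The time normalisation `c = 1` -/

/-- The Kerr exterior reaches spatial infinity: it has points of arbitrarily large Kerr–Schild radius
(the leaf point `(0, y)`, `y = (K' + |a|) e₁`, has `r² ≥ ‖y‖² − a² ≥ K'²`). [folklore] -/
private theorem exists_mem_exterior_le_radius (M a K : ℝ) :
    ∃ x ∈ (Kerr.exterior M a : Set E4), K ≤ Kerr.radius a x := by
  set K' : ℝ := max K (max (Kerr.rPlus M a) 0 + 1) with hK'
  have hK'0 : 0 ≤ K' := le_max_of_le_right (by positivity)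
  set y : E3 := EuclideanSpace.single 0 (K' + |a|) with hy
  have hyn : ‖y‖ = K' + |a| := by
    rw [hy, PiLp.norm_single, Real.norm_eq_abs, abs_of_nonneg (by positivity)]
  set x : E4 := E4.ofTimeSpace 0 y with hx
  have h1 := Kerr.spatialNorm_sq_sub_sq_le_radius_sq a x
  rw [hx, E4.spatialNorm_ofTimeSpace, hyn] at h1
  have h2 : K' ^ 2 ≤ Kerr.radius a (E4.ofTimeSpace 0 y) ^ 2 := by
    nlinarith [abs_nonneg a, sq_abs a]
  have h3 : K' ≤ Kerr.radius a (E4.ofTimeSpace 0 y) :=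
    (pow_le_pow_iff_left₀ hK'0 (Kerr.radius_nonneg _ _) two_ne_zero).1 h2
  refine ⟨x, ?_, (le_max_left _ _).trans h3⟩
  rw [hx, SetLike.mem_coe, Kerr.mem_exterior]
  have : max (Kerr.rPlus M a) 0 + 1 ≤ K' := le_max_right _ _
  linarith

/-- `g_{M,a}(x)(e₀, e₀) = −1 + 2H(x)` (`ℓ₀ = 1`). Kerr–Schild 1965, §2. [folklore] -/
private theorem kerr_bilin_basisVector_zero_zero (M a : ℝ) (x : E4) :
    Kerr.bilin M a x (E4.basisVector 0) (E4.basisVector 0) = -1 + 2 * Kerr.scalarH M a x := by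
  have h0 : Kerr.nullCovectorFun a x 0 = 1 := rfl
  rw [Kerr.bilin_basisVector, h0]
  simp [Kerr.etaComp]

/-- **Registered helper `kerrAsymptoticRigidity_c_eq_one`** (layer 1 of F4 = `KerrAsymptoticRigidity`, whose binder
list is repeated verbatim): a `T`-equivariant (`Θ (x + s e₀) = Θ x + (c s) e₀`, `c > 0`) isometry `Θ` from the
Kerr–Schild form `g_{M,a}` on the sub-extremal Kerr exterior to the components `A.bilin` of an asymptotically
Cartesian adapted chart, sending infinity to infinity, has `c = 1`. Indeed `dΘ (e₀) = c e₀`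
(`fderiv_apply_basisVector_zero_of_contDiffOn`), so the isometry clause at `(e₀, e₀)` reads
`c² A.bilin (Θ x)(e₀, e₀) = g_{M,a}(x)(e₀, e₀) = −1 + 2H(x)` with `0 ≤ 2H(x) ≤ 2M/r(x)` (`Kerr.scalarH_le_div`),
while `|A.bilin (Θ x)(e₀, e₀) + 1| ≤ ‖A.bilin (Θ x) − η‖ ≤ ε` once the `A`-radius of `Θ x` is large (clause (1)
of `ChartIsAsymptoticallyCartesian`), which the end-matching clause grants for `r(x)` large; hence
`|c² − 1| ≤ c² ε + 2M/r(x)` for every `ε > 0` at points of arbitrarily large `r`, i.e. `c² = 1`.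
Chruściel–Costa arXiv:0806.0016, §2.1 (`g(T, T) → −1` at `i⁰` fixes the Killing normalisation). [folklore] -/
theorem kerrAsymptoticRigidity_c_eq_one : ∀ (𝓑 : StationaryAFBlackHole.{0}) (A : 𝓑.AdaptedChart) (M a c : ℝ) (Θ : E4 → E4), ChartIsAsymptoticallyCartesian A → ChartIsAsymptoticallySchwarzschildean' A → Kerr.IsSubextremal M a → 0 < c → ContDiffOn ℝ ∞ Θ (Kerr.exterior M a : Set E4) → Set.InjOn Θ (Kerr.exterior M a : Set E4) → Set.MapsTo Θ (Kerr.exterior M a : Set E4) (A.domain : Set E4) → (∀ x ∈ (Kerr.exterior M a : Set E4), ∀ s : ℝ, Θ (x + s • E4.basisVector 0) = Θ x + (c * s) • E4.basisVector 0) → (∀ x ∈ (Kerr.exterior M a : Set E4), ∀ v w : E4, A.bilin (Θ x) (fderiv ℝ Θ x v) (fderiv ℝ Θ x w) = Kerr.bilin M a x v w) → Θ '' (Kerr.exterior M a : Set E4) = {u : E4 | ∃ h : u ∈ A.domain, A.toFun ⟨u, h⟩ ∈ 𝓑.doc} → (∀ R₁ : ℝ, ∃ R : ℝ, ∀ x ∈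 (Kerr.exterior M a : Set E4), R ≤ Kerr.radius a x → R₁ ≤ A.radius (Θ x)) → c = 1 := by
  intro 𝓑 A M a c Θ hcart _ hMa hc hΘs _ hΘmaps hΘT hΘiso _ hfar
  have hM : 0 < M := hMa.pos
  have hSo : IsOpen (Kerr.exterior M a : Set E4) := (Kerr.exterior M a).isOpen
  -- the key estimate `|c² − 1| ≤ c² ε + 2M/r` far out
  have key : ∀ ε : ℝ, 0 < ε → ∃ R : ℝ, ∀ x ∈ (Kerr.exterior M a : Set E4), R ≤ Kerr.radius a x →
      |c ^ 2 - 1| ≤ c ^ 2 * ε + 2 * M / Kerr.radius a x := by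
    intro ε hε
    obtain ⟨R₀, hR₀⟩ := hcart.1 ε hε
    obtain ⟨R, hR⟩ := hfar R₀
    refine ⟨R, fun x hx hxR ↦ ?_⟩
    have hr : 0 < Kerr.radius a x := Kerr.radius_pos_of_mem_region hx
    have hA : ‖A.bilin (Θ x) - Minkowski.bilin‖ ≤ ε := hR₀ ⟨Θ x, hΘmaps hx⟩ (hR x hx hxR)
    have he₀ : fderiv ℝ Θ x (E4.basisVector 0) = c • E4.basisVector 0 :=
      fderiv_apply_basisVector_zero_of_contDiffOn hSo (by simp) hΘs hΘT hx
    have hiso := hΘiso x hx (E4.basisVector 0) (E4.basisVector 0)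
    rw [he₀, kerr_bilin_basisVector_zero_zero] at hiso
    simp only [map_smul, FunLike.coe_smul, Pi.smul_apply, smul_eq_mul] at hiso
    -- `hiso : c * (c * A₀₀) = -1 + 2H`
    have hδ := (A.bilin (Θ x) - Minkowski.bilin).le_opNorm₂ (E4.basisVector 0) (E4.basisVector 0)
    rw [sub_apply, sub_apply, Minkowski.bilin_basisVector_zero, norm_basisVector_zero, mul_one, mul_one,
      Real.norm_eq_abs, sub_neg_eq_add] at hδ
    have hH0 : 0 ≤ Kerr.scalarH M a x := Kerr.scalarH_nonneg hM.le a x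
    have hH1 : Kerr.scalarH M a x ≤ M / Kerr.radius a x := Kerr.scalarH_le_div hM.le a hr
    have e : c ^ 2 - 1 = c ^ 2 * (A.bilin (Θ x) (E4.basisVector 0) (E4.basisVector 0) + 1) -
        2 * Kerr.scalarH M a x := by linear_combination -hiso
    rw [e]
    refine (abs_sub _ _).trans ?_
    rw [abs_mul, abs_of_nonneg (sq_nonneg c), abs_of_nonneg (by positivity : (0 : ℝ) ≤ 2 * Kerr.scalarH M a x),
      mul_div_assoc]
    gcongr
    exact hδ.trans hA
  -- conclusion: `c² = 1`
  have hc2 : c ^ 2 = 1 := by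
    by_contra hc1
    have hd : 0 < |c ^ 2 - 1| := abs_pos.2 (sub_ne_zero.2 hc1)
    set d : ℝ := |c ^ 2 - 1| with hd_def
    obtain ⟨R, hR⟩ := key (d / (2 * (c ^ 2 + 1))) (by positivity)
    obtain ⟨x, hx, hxR⟩ := exists_mem_exterior_le_radius M a (max R (8 * M / d))
    have hr : 0 < Kerr.radius a x := Kerr.radius_pos_of_mem_region hx
    have h := hR x hx ((le_max_left _ _).trans hxR)
    have hr8 : 8 * M / d ≤ Kerr.radius a x := (le_max_right _ _).trans hxR
    have h1 : 2 * M / Kerr.radius a x ≤ d / 4 := by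
      rw [div_le_iff₀ hr]
      rw [div_le_iff₀ hd] at hr8
      linarith
    have h2 : c ^ 2 * (d / (2 * (c ^ 2 + 1))) ≤ d / 2 := by
      rw [mul_div_assoc', div_le_div_iff₀ (by positivity) (by positivity)]
      nlinarith [sq_nonneg c]
    linarith
  have h := (pow_eq_one_iff_of_nonneg hc.le two_ne_zero).1 hc2
  exact h

/-! ## §3 Two-sided bounds on `dΘ` far out -/

/-- **Registered helper `kerrAsymptoticRigidity_fderiv_bounded`** (layer 2 of F4 = `KerrAsymptoticRigidity`, binder list
verbatim): under the hypotheses of F4 there are `R, L` such that at every point `u` of the Kerr exterior with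
`r(u) ≥ R` the differential of `Θ` satisfies `‖dΘ_u‖ ≤ L` AND `‖v‖ ≤ L ‖dΘ_u v‖` (so `dΘ_u` is invertible with
`‖dΘ_u⁻¹‖ ≤ L`). Far out both forms are `1/4`-close to `η` in operator norm — `g_{M,a}(u)` by
`‖g_{M,a} − η‖ ≤ C/r` (`Kerr.exists_norm_ksPert_le`), `A.bilin (Θ u)` by clause (1) of
`ChartIsAsymptoticallyCartesian` and the end-matching clause — and `dΘ_u` intertwines them with
`dΘ_u e₀ = c e₀`; the bounds are then the linear algebra of `norm_le_of_intertwines` (the `g_{M,a}`-orthogonal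
complement of `e₀` is mapped isometrically onto the `A.bilin`-orthogonal complement of `e₀`, both uniformly
spacelike). O'Neill 1983, Ch. 5, Lemma 5.26; Bartnik 1986, §3 (first step of transition rigidity). [folklore] -/
theorem kerrAsymptoticRigidity_fderiv_bounded : ∀ (𝓑 : StationaryAFBlackHole.{0}) (A : 𝓑.AdaptedChart) (M a c : ℝ) (Θ : E4 → E4), ChartIsAsymptoticallyCartesian A → ChartIsAsymptoticallySchwarzschildean' A → Kerr.IsSubextremal M a → 0 < c → ContDiffOn ℝ ∞ Θ (Kerr.exterior M a : Set E4) → Set.InjOn Θ (Kerr.exterior M a : Set E4) → Set.MapsTo Θ (Kerr.exterior M a : Set E4) (A.domain : Set E4) → (∀ x ∈ (Kerr.exterior M a : Set E4), ∀ s : ℝ, Θ (x + s • E4.basisVector 0) = Θ x + (c * s) • E4.basisVector 0) → (∀ x ∈ (Kerr.exterior M a : Set E4), ∀ v w : E4, A.bilin (Θ x) (fderiv ℝ Θ x v) (fderiv ℝ Θ x w) = Kerr.bilin M a x v w) → Θ '' (Kerr.exterior M a : Set E4) = {u : E4 | ∃ h : u ∈ A.domain, A.toFun ⟨u, h⟩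 ∈ 𝓑.doc} → (∀ R₁ : ℝ, ∃ R : ℝ, ∀ x ∈ (Kerr.exterior M a : Set E4), R ≤ Kerr.radius a x → R₁ ≤ A.radius (Θ x)) → ∃ R L : ℝ, ∀ u ∈ (Kerr.exterior M a : Set E4), R ≤ Kerr.radius a u → ‖fderiv ℝ Θ u‖ ≤ L ∧ ∀ v : E4, ‖v‖ ≤ L * ‖fderiv ℝ Θ u v‖ := by
  intro 𝓑 A M a c Θ hcart _ _ hc hΘs _ hΘmaps hΘT hΘiso _ hfar
  have hSo : IsOpen (Kerr.exterior M a : Set E4) := (Kerr.exterior M a).isOpen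
  obtain ⟨CK, RK, _, hK⟩ := Kerr.exists_norm_ksPert_le M a
  obtain ⟨R₀, hR₀⟩ := hcart.1 (1 / 4) (by norm_num)
  obtain ⟨R₁, hR₁⟩ := hfar R₀
  refine ⟨max (max RK (4 * CK)) R₁, max (16 / 3 + 5 * c / 3) (16 / 3 + 5 / (3 * c)), fun u hu huR ↦ ?_⟩
  have hr : 0 < Kerr.radius a u := Kerr.radius_pos_of_mem_region hu
  have hKu : ‖Kerr.bilin M a u - Minkowski.bilin‖ ≤ 1 / 4 := by
    refine (hK u (((le_max_left _ _).trans (le_max_left _ _)).trans huR)).trans ?_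
    rw [div_le_iff₀ hr]
    linarith [((le_max_right _ _).trans (le_max_left _ _)).trans huR]
  have hAu : ‖A.bilin (Θ u) - Minkowski.bilin‖ ≤ 1 / 4 :=
    hR₀ ⟨Θ u, hΘmaps hu⟩ (hR₁ u hu ((le_max_right _ _).trans huR))
  have he₀ : fderiv ℝ Θ u (E4.basisVector 0) = c • E4.basisVector 0 :=
    fderiv_apply_basisVector_zero_of_contDiffOn hSo (by simp) hΘs hΘT hu
  obtain ⟨h1, h2⟩ := norm_le_of_intertwines hKu hAu hc he₀ (hΘiso u hu)
  exact ⟨h1.trans (le_max_left _ _), fun v ↦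
    (h2 v).trans (mul_le_mul_of_nonneg_right (le_max_right _ _) (norm_nonneg _))⟩

end Summit.FinalStateConjecture.FinalStateConjecture.Theorems.SymplecticDualOfTheBomb

end
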